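import Mathlib
import Summits.Ventures.PercRepro2.SwOutMixedPartOrbitDefs
import Summits.Ventures.PercRepro2.SwOutSevCore
import Summits.Ventures.PercRepro2.SwOutSevOrbitHull

/-!
# The coarse orbit of a core-free point of a several-arms block stays in the block (blind cell
PercRepro2, night-4 g22, 2026-08-27; proofs/NIGHT4-G22.md §4)

At a non-leaking point `q` of a several-arms base whose arm sets are connected inside themselves,
an ARM-CLOSED set `W` (a union of coarse arms of the realisation `ζ' = mixedRealR σ q`) contains
or misses every class vertex set, `u` together with every u-arm (`U_subset_iff_R`), a dropped
vertex of the hull together with `u` (`u_mem_of_p_mem_R`, `p_mem_of_u_mem_R`), a piece together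
with its dropped vertex when that is in the hull (`Ah_subset_of_p_mem_R`, `p_mem_of_Ah_subset_R`).
Hence the flip of `W` is the realisation of the TOGGLED point `toggleWR q W`
(**`flip_armClosed_eq_mixedRealR`**), which does not leak when `q` is a slab point
(**`not_leak_toggleWR`**: with `u ∈ W` a T-slab point goes to a B-slab point and back, with
`u ∉ W` only the pieces of the dropped arms and the far arms toggle).  A core-free non-leaking
point is a slab point (`slab_of_coreFree`), so **every point of the coarse orbit of a core-free
point of the block is a point of the block** (`exists_mixedRealR_of_mem_orbit`).
-/

namespace Summit.Ventures.PercRepro2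

namespace MixedArms

open Hull LocRows BigBlock

variable {V : Type*} {E : Type*} [Fintype E] [DecidableEq E]

open scoped Classical

variable {ι ρ ν κ : Type*} {ends : E → Sym2 V} {σ : Config E} {h u : V} {U : ι → Set V}
  {p : ρ → V} {Ah : ν → Set V} {arm : ν → ρ} {F : κ → Set V}

variable (hb : MixedBaseR ends σ h u U p Ah arm F)
include hb

section Closed

variable (hup : ∀ r, ∃ e, ends e = s(u, p r)) {q : PtR ι ρ ν κ} (hqR : ¬ LeakRR arm q)
  (hqB : ¬ LeakBR arm q) {W : Set V} (hW : ArmClosed ends (mixedRealR ends u U p Ah F σ q) h W)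
include hup hqR hqB hW

omit [Fintype E] [DecidableEq E] in
/-- A vertex outside the structure is not in `W`. -/
lemma MixedBaseR.not_mem_W_of_out_R {z : V} (hzh : z ≠ h) (hzu : z ≠ u) (hzp : ∀ r, z ≠ p r)
    (hzo : z ∉ armsAllR U Ah F) : z ∉ W := by
  intro hz
  have hzH := hb.hull_mixedRealR_subset hup hqR hqB (hW.subset z hz).1
  rcases hzH with ((hzH | hzH) | ⟨r, hr⟩) | hzH
  · exact hzh hzH
  · exact hzu hzH
  · exact hzp r hr.symm
  · exact hzo hzH

omit [Fintype E] [DecidableEq E] in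
/-- A dropped vertex in `W` brings `u` into `W`. -/
lemma MixedBaseR.u_mem_of_p_mem_R [Nonempty ι] {r : ρ} (hp : p r ∈ W) : u ∈ W := by
  obtain ⟨e, he⟩ := hup r
  exact hW.closed e (p r) u (ends_swap he) hp (hb.u_mem_hull_R hup hqR hqB) hb.hne_hu.symm

omit [Fintype E] [DecidableEq E] hqR hqB in
/-- `u` in `W` brings every dropped vertex of the hull into `W`. -/
lemma MixedBaseR.p_mem_of_u_mem_R (huW : u ∈ W) {r : ρ}
    (hpH : p r ∈ hull ends (mixedRealR ends u U p Ah F σ q) h) : p r ∈ W := by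
  obtain ⟨e, he⟩ := hup r
  exact hW.closed e u (p r) he huW hpH (hb.hne_hp r).symm

omit [Fintype E] [DecidableEq E] in
/-- A u-arm lies in `W` iff `u` does (the u-arm connected inside itself). -/
lemma MixedBaseR.U_subset_iff_R [Nonempty ι] (j : ι)
    (hconnU : ∀ x ∈ U j, ∀ y ∈ U j, y ∈ cluster ends (fun e => decide (e ∈ within ends (U j))) x) :
    U j ⊆ W ↔ u ∈ W := by
  obtain ⟨e, x, hex, hx⟩ := hb.u_adj_U j
  have hxH : x ∈ hull ends (mixedRealR ends u U p Ah F σ q) h :=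
    hb.armsAllR_subset_hull hup hqR hqB (Or.inl (Or.inl (Set.mem_iUnion.2 ⟨j, hx⟩)))
  constructor
  · intro hsub
    exact hW.closed e x u (ends_swap hex) (hsub hx) (hb.u_mem_hull_R hup hqR hqB) hb.hne_hu.symm
  · intro huW
    have hxW : x ∈ W := hW.closed e u x hex huW hxH (fun h' => hb.h_notMem_U j (h' ▸ hx))
    rcases subset_or_disjoint_of_armClosed hW
        (fun v hv => ⟨hb.armsAllR_subset_hull hup hqR hqB (Or.inl (Or.inl (Set.mem_iUnion.2 ⟨j, hv⟩))),
          fun h' => hb.h_notMem_U j (h' ▸ hv)⟩) hconnU with hsub | hdisj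
    · exact hsub
    · exact absurd hxW (hdisj x hx)

omit [Fintype E] [DecidableEq E] in
/-- A piece lies in `W` when its dropped vertex does (the piece connected inside itself). -/
lemma MixedBaseR.Ah_subset_of_p_mem_R (i : ν) {e : E} {y : V} (hey : ends e = s(p (arm i), y))
    (hy : y ∈ Ah i)
    (hconnA : ∀ x ∈ Ah i, ∀ z ∈ Ah i, z ∈ cluster ends (fun e => decide (e ∈ within ends (Ah i))) x)
    (hp : p (arm i) ∈ W) : Ah i ⊆ W := by
  have hyH : y ∈ hull ends (mixedRealR ends u U p Ah F σ q) h :=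
    hb.armsAllR_subset_hull hup hqR hqB (Or.inl (Or.inr (Set.mem_iUnion.2 ⟨i, hy⟩)))
  have hyW : y ∈ W := hW.closed e (p (arm i)) y hey hp hyH (fun h' => hb.h_notMem_Ah i (h' ▸ hy))
  rcases subset_or_disjoint_of_armClosed hW
      (fun v hv => ⟨hb.armsAllR_subset_hull hup hqR hqB (Or.inl (Or.inr (Set.mem_iUnion.2 ⟨i, hv⟩))),
        fun h' => hb.h_notMem_Ah i (h' ▸ hv)⟩) hconnA with hsub | hdisj
  · exact hsub
  · exact absurd hyW (hdisj y hy)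

omit [Fintype E] [DecidableEq E] hup hqR hqB in
/-- A piece in `W` brings its dropped vertex into `W` when that lies in the hull. -/
lemma MixedBaseR.p_mem_of_Ah_subset_R (i : ν) {e : E} {y : V} (hey : ends e = s(p (arm i), y))
    (hy : y ∈ Ah i) (hsub : Ah i ⊆ W)
    (hpH : p (arm i) ∈ hull ends (mixedRealR ends u U p Ah F σ q) h) : p (arm i) ∈ W :=
  hW.closed e y (p (arm i)) (ends_swap hey) (hsub hy) hpH (hb.hne_hp (arm i)).symm

end Closed

section Flip

variable (hup : ∀ r, ∃ e, ends e = s(u, p r))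
  (hdead : ∀ i, ∃ e y, ends e = s(p (arm i), y) ∧ y ∈ Ah i)
  (hconnU : ∀ j, ∀ x ∈ U j, ∀ y ∈ U j, y ∈ cluster ends (fun e => decide (e ∈ within ends (U j))) x)
  (hconnA : ∀ i, ∀ x ∈ Ah i, ∀ y ∈ Ah i, y ∈ cluster ends (fun e => decide (e ∈ within ends (Ah i))) x)
  (hconnF : ∀ k, ∀ x ∈ F k, ∀ y ∈ F k, y ∈ cluster ends (fun e => decide (e ∈ within ends (F k))) x)
  {q : PtR ι ρ ν κ} (hqR : ¬ LeakRR arm q) (hqB : ¬ LeakBR arm q)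
  {W : Set V} (hW : ArmClosed ends (mixedRealR ends u U p Ah F σ q) h W)
include hup hdead hconnU hconnA hconnF hqR hqB hW

omit [Fintype E] [DecidableEq E] in
/-- **The flip of a union of coarse arms is a point of the raw cube**: the classes inside `W`
toggled. -/
theorem MixedBaseR.flip_armClosed_eq_mixedRealR [Nonempty ι] :
    flip ends W (mixedRealR ends u U p Ah F σ q) =
      mixedRealR ends u U p Ah F σ (toggleWR u p Ah F q W) := by
  have hhW : h ∉ W := fun hh => (hW.subset h hh).2 rfl
  have hUiff := fun j => hb.U_subset_iff_R hup hqR hqB hW j (hconnU j)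
  have hout : ∀ {z : V}, z ≠ h → z ≠ u → (∀ r, z ≠ p r) → z ∉ armsAllR U Ah F → z ∉ W :=
    fun hzh hzu hzp hzo => hb.not_mem_W_of_out_R hup hqR hqB hW hzh hzu hzp hzo
  funext e
  by_cases hU : ∃ j, e ∈ touches ends (U j)
  · obtain ⟨j, hj⟩ := hU
    have hmem : e ∈ touches ends W ↔ u ∈ W := by
      obtain ⟨x, y, hxy, hx, hy⟩ := hb.ends_of_touches_U hj
      have hsd := subset_or_disjoint_of_armClosed hW
        (fun v hv => ⟨hb.armsAllR_subset_hull hup hqR hqB (Or.inl (Or.inl (Set.mem_iUnion.2 ⟨j, hv⟩))),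
          fun h' => hb.h_notMem_U j (h' ▸ hv)⟩) (hconnU j)
      constructor
      · rintro ⟨z, hzW, w, hzw⟩
        have hz : z = x ∨ z = y := by
          rw [hxy, Sym2.eq_iff] at hzw
          rcases hzw with ⟨h1, _⟩ | ⟨_, h2⟩
          · exact Or.inl h1.symm
          · exact Or.inr h2.symm
        rcases hsd with hsub | hdisj
        · exact (hUiff j).1 hsub
        · exfalso
          rcases hz with rfl | rfl
          · exact hdisj z hx hzW
          · rcases hy with hy | rfl | rfl | ⟨hyh, hyu, hyp, hyo⟩
            · exact hdisj z hy hzW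
            · exact hhW hzW
            · exact hdisj x hx ((hUiff j).2 hzW hx)
            · exact hout hyh hyu hyp hyo hzW
      · intro huW
        exact ⟨x, (hUiff j).2 huW hx, y, hxy⟩
    by_cases huW : u ∈ W
    · rw [flip_apply_of_mem (hmem.2 huW), hb.mixedRealR_apply_U hj, hb.mixedRealR_apply_U hj]
      simp only [toggleWR, if_pos huW]
      cases q.1 j <;> simp
    · rw [flip_apply_of_notMem (fun h' => huW (hmem.1 h')), hb.mixedRealR_apply_U hj,
        hb.mixedRealR_apply_U hj]
      simp only [toggleWR, if_neg huW]
  by_cases hA : ∃ i, e ∈ touches ends (Ah i)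
  · obtain ⟨i, hi⟩ := hA
    obtain ⟨e₀, y₀, he₀, hy₀⟩ := hdead i
    have hmem : e ∈ touches ends W ↔ Ah i ⊆ W := by
      obtain ⟨x, y, hxy, hx, hy⟩ := hb.ends_of_touches_Ah hi
      have hsd := subset_or_disjoint_of_armClosed hW
        (fun v hv => ⟨hb.armsAllR_subset_hull hup hqR hqB (Or.inl (Or.inr (Set.mem_iUnion.2 ⟨i, hv⟩))),
          fun h' => hb.h_notMem_Ah i (h' ▸ hv)⟩) (hconnA i)
      constructor
      · rintro ⟨z, hzW, w, hzw⟩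
        have hz : z = x ∨ z = y := by
          rw [hxy, Sym2.eq_iff] at hzw
          rcases hzw with ⟨h1, _⟩ | ⟨_, h2⟩
          · exact Or.inl h1.symm
          · exact Or.inr h2.symm
        rcases hsd with hsub | hdisj
        · exact hsub
        · exfalso
          rcases hz with rfl | rfl
          · exact hdisj z hx hzW
          · rcases hy with hy | rfl | rfl | ⟨hyh, hyu, hyp, hyo⟩
            · exact hdisj z hy hzW
            · exact hhW hzW
            · exact hdisj x hx (hb.Ah_subset_of_p_mem_R hup hqR hqB hW i he₀ hy₀ (hconnA i) hzW hx)
            · exact hout hyh hyu hyp hyo hzW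
      · intro hsub
        exact ⟨x, hsub hx, y, hxy⟩
    by_cases hsub : Ah i ⊆ W
    · rw [flip_apply_of_mem (hmem.2 hsub), hb.mixedRealR_apply_Ah hi, hb.mixedRealR_apply_Ah hi]
      simp only [toggleWR, if_pos hsub]
      cases q.2.1 i <;> simp
    · rw [flip_apply_of_notMem (fun h' => hsub (hmem.1 h')), hb.mixedRealR_apply_Ah hi,
        hb.mixedRealR_apply_Ah hi]
      simp only [toggleWR, if_neg hsub]
  by_cases hUP : ∃ r, e ∈ clsUPR ends u p r
  · obtain ⟨r, hr⟩ := hUP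
    have hmem : e ∈ touches ends W ↔ u ∈ W := by
      have hup' : ends e = s(u, p r) := hr
      constructor
      · rintro ⟨z, hzW, w, hzw⟩
        rw [hup', Sym2.eq_iff] at hzw
        rcases hzw with ⟨h1, _⟩ | ⟨_, h2⟩
        · rw [← h1] at hzW; exact hzW
        · rw [← h2] at hzW; exact hb.u_mem_of_p_mem_R hup hqR hqB hW hzW
      · intro huW
        exact ⟨u, huW, p r, hup'⟩
    by_cases huW : u ∈ W
    · rw [flip_apply_of_mem (hmem.2 huW), hb.mixedRealR_apply_UP hr, hb.mixedRealR_apply_UP hr]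
      simp only [toggleWR, if_pos huW]
      cases q.2.2.1 r <;> simp
    · rw [flip_apply_of_notMem (fun h' => huW (hmem.1 h')), hb.mixedRealR_apply_UP hr,
        hb.mixedRealR_apply_UP hr]
      simp only [toggleWR, if_neg huW]
  by_cases hX : ∃ r, e ∈ clsExtR ends u p Ah r
  · obtain ⟨r, hr⟩ := hX
    have hmem : e ∈ touches ends W ↔ p r ∈ W := by
      obtain ⟨z, hpz, hzu, hzA⟩ := hr
      have hzout : z ∉ W := by
        rcases hb.p_edges r e z hpz with hzu' | ⟨i, -, hz⟩ | ⟨hzh, hzp, hzo⟩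
        · exact absurd hzu' hzu
        · exact absurd hz (hzA i)
        · exact hout hzh hzu hzp hzo
      constructor
      · rintro ⟨w, hwW, w', hww'⟩
        rw [hpz, Sym2.eq_iff] at hww'
        rcases hww' with ⟨h1, _⟩ | ⟨_, h2⟩
        · rw [← h1] at hwW; exact hwW
        · rw [← h2] at hwW; exact absurd hwW hzout
      · intro hpW
        exact ⟨p r, hpW, z, hpz⟩
    by_cases hpW : p r ∈ W
    · rw [flip_apply_of_mem (hmem.2 hpW), hb.mixedRealR_apply_Ext hr, hb.mixedRealR_apply_Ext hr]
      simp only [toggleWR, if_pos hpW]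
      cases q.2.2.2.1 r <;> simp
    · rw [flip_apply_of_notMem (fun h' => hpW (hmem.1 h')), hb.mixedRealR_apply_Ext hr,
        hb.mixedRealR_apply_Ext hr]
      simp only [toggleWR, if_neg hpW]
  by_cases hF : ∃ k, e ∈ touches ends (F k)
  · obtain ⟨k, hk⟩ := hF
    have hmem : e ∈ touches ends W ↔ F k ⊆ W := by
      obtain ⟨x, y, hxy, hx, hy⟩ := hb.ends_of_touches_F hk
      have hsd := subset_or_disjoint_of_armClosed hW
        (fun v hv => ⟨hb.armsAllR_subset_hull hup hqR hqB (Or.inr (Set.mem_iUnion.2 ⟨k, hv⟩)),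
          fun h' => hb.h_notMem_F k (h' ▸ hv)⟩) (hconnF k)
      constructor
      · rintro ⟨z, hzW, w, hzw⟩
        have hz : z = x ∨ z = y := by
          rw [hxy, Sym2.eq_iff] at hzw
          rcases hzw with ⟨h1, _⟩ | ⟨_, h2⟩
          · exact Or.inl h1.symm
          · exact Or.inr h2.symm
        rcases hsd with hsub | hdisj
        · exact hsub
        · exfalso
          rcases hz with rfl | rfl
          · exact hdisj z hx hzW
          · rcases hy with hy | rfl | ⟨hyh, hyu, hyp, hyo⟩
            · exact hdisj z hy hzW
            · exact hhW hzW
            · exact hout hyh hyu hyp hyo hzW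
      · intro hsub
        exact ⟨x, hsub hx, y, hxy⟩
    by_cases hsub : F k ⊆ W
    · rw [flip_apply_of_mem (hmem.2 hsub), hb.mixedRealR_apply_F hk, hb.mixedRealR_apply_F hk]
      simp only [toggleWR, if_pos hsub]
      cases q.2.2.2.2 k <;> simp
    · rw [flip_apply_of_notMem (fun h' => hsub (hmem.1 h')), hb.mixedRealR_apply_F hk,
        hb.mixedRealR_apply_F hk]
      simp only [toggleWR, if_neg hsub]
  · -- no class: the edge touches neither `W` nor any class
    have hU' : ∀ j, e ∉ touches ends (U j) := fun j hj => hU ⟨j, hj⟩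
    have hA' : ∀ i, e ∉ touches ends (Ah i) := fun i hi => hA ⟨i, hi⟩
    have hUP' : ∀ r, e ∉ clsUPR ends u p r := fun r hr => hUP ⟨r, hr⟩
    have hX' : ∀ r, e ∉ clsExtR ends u p Ah r := fun r hr => hX ⟨r, hr⟩
    have hF' : ∀ k, e ∉ touches ends (F k) := fun k hk => hF ⟨k, hk⟩
    have hnot : e ∉ touches ends W := by
      rintro ⟨z, hzW, w, hzw⟩
      have hzH := hb.hull_mixedRealR_subset hup hqR hqB (hW.subset z hzW).1
      rcases hzH with ((hzh | hzu) | ⟨r, hzp⟩) | hz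
      · rw [hzh] at hzW; exact hhW hzW
      · rw [hzu] at hzw
        rcases hb.u_edges e w hzw with ⟨j, hj⟩ | ⟨r, hwp⟩
        · exact hU' j ⟨w, hj, u, ends_swap hzw⟩
        · rw [hwp] at hzw; exact hUP' r hzw
      · rw [← hzp] at hzw
        rcases hb.p_edges r e w hzw with hwu | ⟨i, -, hw⟩ | ⟨_, _, hwo⟩
        · rw [hwu] at hzw; exact hUP' r (ends_swap hzw)
        · exact hA' i ⟨w, hw, p r, ends_swap hzw⟩
        · by_cases hwu : w = u
          · rw [hwu] at hzw; exact hUP' r (ends_swap hzw)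
          · exact hX' r ⟨w, hzw, hwu, fun i hw => hwo (Or.inl (Or.inr (Set.mem_iUnion.2 ⟨i, hw⟩)))⟩
      · rcases hz with (hz | hz) | hz
        · obtain ⟨j, hj⟩ := Set.mem_iUnion.1 hz
          exact hU' j ⟨z, hj, w, hzw⟩
        · obtain ⟨i, hi⟩ := Set.mem_iUnion.1 hz
          exact hA' i ⟨z, hi, w, hzw⟩
        · obtain ⟨k, hk⟩ := Set.mem_iUnion.1 hz
          exact hF' k ⟨z, hk, w, hzw⟩
    rw [flip_apply_of_notMem hnot, MixedBaseR.mixedRealR_apply_none hU' hA' hUP' hX' hF',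
      MixedBaseR.mixedRealR_apply_none hU' hA' hUP' hX' hF']

end Flip

end MixedArms

end Summit.Ventures.PercRepro2
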